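import Literature.Geometry.Kaehler.ComplexTorusAbelianThreefoldTimesEllipticCurve
import HarnessLib

/-!
# Moonen–Zarhin 1999 (5.4)–(5.5) for the fourfolds `T × E`, `T` a NON-SIMPLE threefold: Prop. (3.8) for a product
# `X = X₁ × X₂` («`C = K₁ × ⋯ × K_m × F₁ × ⋯ × F_n` … an embedding `k → F_i`»), and Thm. (0.1) (4) for every
# polarised complex abelian threefold against every elliptic curve outside case (a)

Layer `Literature/Geometry/Kaehler`, namespace `Literature.Geometry.Kaehler.ComplexTorus`; lane `lit-hodgefound`
(Track 2 foundations library), Layer A4 (known cases of `D = B`), prover seat `lit-hodgefound-p17` (generation 51),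
self-proposed row g51-#6 — sequel of g51-#5 (`ComplexTorusAbelianThreefoldTimesEllipticCurve`: `T × E_τ` satisfies
(D) for `T` SIMPLE outside case (a) and for any `T` when `E_τ` has no complex multiplication).  Here the remaining
fourfolds `T × E_τ` with `T ∼ Y × E_{τ'}` NON-simple and `E_τ` WITH complex multiplication, along Moonen–Zarhin §5:
«(5.4) … We can write `X ∼ X₁ × X₂^r` with `r ≥ 1` and `Hom(X₂, X₁) = 0`. … If `r > 1` then we are reduced to the case
`g ≤ 3`, since `Hg(X₁ × X₂^r) ≅ Hg(X₁ × X₂)`» and «(5.5) … If we are not in case (a) then there is no embedding of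
`End⁰(X₁)` into the center of `End⁰(X₂)`. It thus follows from Proposition (3.8) that `Hg(X) = Hg(X₁) × Hg(X₂^r)`»,
with the proof of (3.8): «Write `C` for the center of `End⁰(X)`. Then `C` has the form `C = K₁ × ⋯ × K_m × F₁ × ⋯ ×
F_n` … there exists an embedding `k → F_i`».  THEOREMS ONLY (no definition, no instance, no notation, no named fact;
D-0026, net debt 0).

## Sources, VERBATIM (held `paper:arxiv-math_9901113`)

* B. J. J. Moonen, Yu. G. Zarhin [MoonenZarhin1999LowDim], *Hodge classes on abelian varieties of low dimension*, Math.
  Ann. **315** (1999).  §3 Prop. (3.8) (p0007 L55–L59): «Let `X` be an abelian variety and let `E` be an elliptic curve,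
  both over `ℂ`. Suppose `Hom(E,X) = 0`. Then either `Hg(X × E) = Hg(X) × Hg(E)` or `End⁰(E) = k` is an imaginary
  quadratic field such that there exists an embedding of `k` into the center of `End⁰(X)`.»; its proof (p0007 L65–L74):
  «Write `C` for the center of `End⁰(X)`. Then `C` has the form `C = K₁ × ⋯ × K_m × F₁ × ⋯ × F_n`, where `K₁, …, K_m`
  are totally real fields and `F₁, ⋯, F_n` are CM-fields. … If `U_{F_i}` is a factor such that the projection of `U_k`
  to `U_{F_i}` has rank 1 then it easily follows from Lemma (3.6) that there exists an embedding `k → F_i`.»; Cor. (3.9)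
  (p0007 L80–L84): «every product of elliptic curves satisfies condition (D)»; §5 (5.4) (p0009 L82–L91) and (5.5)
  (p0009 L93–L97), quoted above; Thm. (0.1) (4) and case (a) (p0001 L77–L80, L131–L135).
* H. Lange [Lange2023AbelianVarietiesComplex], *Abelian Varieties over the Complex Numbers* (Grundlehren Text Edition,
  2023), §2.4.4 Cor. 2.4.26 and its proof (p. 124: «Since `Hom(X_ν^{n_ν}, X_μ^{n_μ}) = 0` for `ν ≠ μ`, we obtain
  `End_ℚ(X) = ⊕ End_ℚ(X_ν^{n_ν})`»), §5.1.5 Exercise (1) (`End_ℚ` of an elliptic curve: `ℚ` or `ℚ(τ)` imaginary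
  quadratic), §1.1.2 (products).
* B. B. Gordon [Gordon1997], *A survey of the Hodge conjecture for abelian varieties*, 7.6.1–7.6.2 (stably nondegenerate
  products and powers), Thm. 7.5.
* J. H. Silverman [Silverman1994], *Advanced Topics in the Arithmetic of Elliptic Curves*, Ch. II §2 (elliptic curves with
  the same CM field are isogenous; used through the tree's `isIsogenous_ellipticPeriod_of_mem_span_one_tau`).

## The argument

For `X = X₁ × X₂` with `Hom_ℚ(X₁, X₂) = 0 = Hom_ℚ(X₂, X₁)` the tree has `End⁰(X) ≅ End⁰(X₁) × End⁰(X₂)`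
(`endAlgRatProdEquiv`), so the centre is `Z(End⁰ X₁) × Z(End⁰ X₂)` and a `ℚ`-algebra character `χ` of the centre
(the tree's CM half of (3.8), `IsAbelianVariety.exists_eigencharacter_center_endAlgRat_of_hodgeGroupC_prod_ellipticPeriod_ne`,
produces one with `τ ∈ χ(centre)` when `Hg(X × E_τ)(ℂ)` does not split) takes the value `1` on exactly one of the two
central idempotents `(1,0)`, `(0,1)` and factors through that factor (§1: «an embedding `k → F_i`»).  For `X₂ = E_{τ'}`
an elliptic curve a character of `Z(End⁰ E_{τ'}) = End⁰(E_{τ'}) ∈ {ℚ, ℚ + ℚ·M_{τ'}}` with a non-real value `τ` forces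
`τ ∈ ℚ + ℚτ'`, i.e. `E_{τ'} ∼ E_τ` (§2); for `X₁ = Y` a simple abelian surface no character of `Z(End⁰ Y)` takes an
imaginary quadratic value (g51-#1 §1).  Hence for `Y` simple: `Hg((Y × E_{τ'}) × E_τ)(ℂ)` splits unless `E_{τ'} ∼ E_τ`
(§3); split ⟹ (D) by (3.1) from (D) for `Y × E_{τ'}` (g51-#1) and Tate; `E_{τ'} ∼ E_τ` ⟹ `(Y × E_{τ'}) × E_τ ∼ Y × E_τ²`,
(D) by Hazama's power remark from `Y × E_τ` («reduced to the case `g ≤ 3`»); `Y` non-simple ⟹ four elliptic curves,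
Cor. (3.9); `E_τ` without complex multiplication: g51-#5.  A non-simple polarised threefold is `T ∼ Y × E_{τ'}` (g51-#2 §1).

## Contents

* §1 (algebra) characters of the centre of a product algebra factor through one factor:
  `exists_algHom_center_or_of_mem_range_algHom_center_prod`, `…_of_algEquiv_prod`.
* §2 `mem_span_one_tau_of_mem_range_algHom_center_endAlgRat_ellipticPeriod` (a character of `Z(End⁰ E_{τ'})` with a
  non-real value `t` has `t ∈ ℚ + ℚτ'`), `isIsogenous_ellipticPeriod_of_mem_range_algHom_center_endAlgRat`.
* §3 (3.8) for `X = X₁ × X₂`: **`IsAbelianVariety.exists_algHom_center_endAlgRat_or_of_hodgeGroupC_prod_prod_ellipticPeriod_ne`**;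
  for `X = X₁ × E_{τ'}`: `IsAbelianVariety.exists_algHom_center_endAlgRat_or_isIsogenous_of_hodgeGroupC_prod_ellipticPeriod_prod_ellipticPeriod_ne`.
* §4 `Y` a simple abelian surface: **`IsSimple.isIsogenous_ellipticPeriod_of_hodgeGroupC_prod_ellipticPeriod_prod_ellipticPeriod_ne`**,
  `IsSimple.hodgeGroupC_prod_ellipticPeriod_prod_ellipticPeriod_eq_blockDiagProd_of_not_isIsogenous`; every polarised
  surface `Y`: **`IsRiemannForm.forall_divisorClasses_powPeriod_prod_ellipticPeriod_prod_ellipticPeriod_eq_hodgeClasses_of_finrank_eq_two`**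
  (`(Y × E_{τ'}) × E_τ` satisfies (D) for all `τ', τ`).
* §5 threefolds: **`IsRiemannForm.forall_divisorClasses_powPeriod_prod_ellipticPeriod_eq_hodgeClasses_of_not_isSimple_of_finrank_eq_three`**
  (`T × E_τ` satisfies (D) for every NON-SIMPLE polarised threefold `T` and EVERY `E_τ`) and, with g51-#5,
  **`IsRiemannForm.forall_divisorClasses_powPeriod_prod_ellipticPeriod_eq_hodgeClasses_of_finrank_eq_three_of_forall_apply_ne`**:
  Thm. (0.1) (4) for all fourfolds `T × E_τ` outside case (a).
-/

noncomputable section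

open Module Matrix NumberField

namespace Literature.Geometry.Kaehler

namespace ComplexTorus

/-! ## §1 Characters of the centre of a product of algebras («`C = K₁ × ⋯ × F_n` … an embedding `k → F_i`») -/

section CentreOfProduct

variable {R A B C : Type*} [CommRing R] [Ring A] [Ring B] [Algebra R A] [Algebra R B] [Field C] [Algebra R C]

/-- `(a, 0)` is central in `A × B` for `a` central in `A`. [folklore] -/
private theorem inl_mem_center₆ {a : A} (ha : a ∈ Subalgebra.center R A) :
    ((a, 0) : A × B) ∈ Subalgebra.center R (A × B) :=
  Subalgebra.mem_center_iff.2 fun p ↦ Prod.ext (by simpa using Subalgebra.mem_center_iff.1 ha p.1) (by simp)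

/-- `(0, b)` is central in `A × B` for `b` central in `B`. [folklore] -/
private theorem inr_mem_center₆ {b : B} (hb : b ∈ Subalgebra.center R B) :
    ((0, b) : A × B) ∈ Subalgebra.center R (A × B) :=
  Subalgebra.mem_center_iff.2 fun p ↦ Prod.ext (by simp) (by simpa using Subalgebra.mem_center_iff.1 hb p.2)

/-- The first component of a central element of `A × B` is central. [folklore] -/
private theorem fst_mem_center₆ {z : A × B} (hz : z ∈ Subalgebra.center R (A × B)) : z.1 ∈ Subalgebra.center R A :=
  Subalgebra.mem_center_iff.2 fun a ↦ by simpa using congrArg Prod.fst (Subalgebra.mem_center_iff.1 hz (a, 0))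

/-- The second component of a central element of `A × B` is central. [folklore] -/
private theorem snd_mem_center₆ {z : A × B} (hz : z ∈ Subalgebra.center R (A × B)) : z.2 ∈ Subalgebra.center R B :=
  Subalgebra.mem_center_iff.2 fun b ↦ by simpa using congrArg Prod.snd (Subalgebra.mem_center_iff.1 hz (0, b))

/-- A character `χ` of the centre of `A × B` with `χ(1, 0) = 1` restricts along `a ↦ (a, 0)` to a character of the
centre of `A`. [folklore] -/
private theorem exists_algHom_center_fst₆ (χ : Subalgebra.center R (A × B) →ₐ[R] C)
    (h1 : χ ⟨(1, 0), inl_mem_center₆ (Subalgebra.one_mem _)⟩ = 1) :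
    ∃ χ₁ : Subalgebra.center R A →ₐ[R] C,
      ∀ a : Subalgebra.center R A, χ₁ a = χ ⟨((a : A), 0), inl_mem_center₆ a.2⟩ := by
  refine ⟨{ toFun := fun a ↦ χ ⟨((a : A), 0), inl_mem_center₆ a.2⟩
            map_one' := by simpa only [OneMemClass.coe_one] using h1
            map_mul' := fun a a' ↦ by
              show χ _ = χ _ * χ _
              rw [← map_mul]
              exact congrArg χ (Subtype.ext (Prod.ext (by simp) (by simp)))
            map_zero' := by
              have h0 : (⟨(((0 : Subalgebra.center R A) : A), 0), inl_mem_center₆ (0 : Subalgebra.center R A).2⟩ :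
                  Subalgebra.center R (A × B)) = 0 :=
                Subtype.ext (Prod.ext (by simp) (by simp))
              show χ _ = 0
              rw [h0, map_zero]
            map_add' := fun a a' ↦ by
              show χ _ = χ _ + χ _
              rw [← map_add]
              exact congrArg χ (Subtype.ext (Prod.ext (by simp) (by simp)))
            commutes' := fun r ↦ by
              have hr : (⟨(((algebraMap R (Subalgebra.center R A) r : Subalgebra.center R A) : A), 0),
                  inl_mem_center₆ (algebraMap R (Subalgebra.center R A) r).2⟩ : Subalgebra.center R (A × B)) =
                    r • (⟨(1, 0), inl_mem_center₆ (Subalgebra.one_mem _)⟩ : Subalgebra.center R (A × B)) :=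
                Subtype.ext (Prod.ext (by simp [Algebra.algebraMap_eq_smul_one]) (by simp))
              change χ _ = _
              rw [hr, map_smul, h1, Algebra.algebraMap_eq_smul_one] }, fun a ↦ rfl⟩

/-- The same for the second factor: `χ(0, 1) = 1` ⟹ `χ` restricts along `b ↦ (0, b)`. [folklore] -/
private theorem exists_algHom_center_snd₆ (χ : Subalgebra.center R (A × B) →ₐ[R] C)
    (h1 : χ ⟨(0, 1), inr_mem_center₆ (Subalgebra.one_mem _)⟩ = 1) :
    ∃ χ₂ : Subalgebra.center R B →ₐ[R] C,
      ∀ b : Subalgebra.center R B, χ₂ b = χ ⟨(0, (b : B)), inr_mem_center₆ b.2⟩ := by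
  refine ⟨{ toFun := fun b ↦ χ ⟨(0, (b : B)), inr_mem_center₆ b.2⟩
            map_one' := by simpa only [OneMemClass.coe_one] using h1
            map_mul' := fun b b' ↦ by
              show χ _ = χ _ * χ _
              rw [← map_mul]
              exact congrArg χ (Subtype.ext (Prod.ext (by simp) (by simp)))
            map_zero' := by
              have h0 : (⟨(0, ((0 : Subalgebra.center R B) : B)), inr_mem_center₆ (0 : Subalgebra.center R B).2⟩ :
                  Subalgebra.center R (A × B)) = 0 :=
                Subtype.ext (Prod.ext (by simp) (by simp))
              show χ _ = 0
              rw [h0, map_zero]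
            map_add' := fun b b' ↦ by
              show χ _ = χ _ + χ _
              rw [← map_add]
              exact congrArg χ (Subtype.ext (Prod.ext (by simp) (by simp)))
            commutes' := fun r ↦ by
              have hr : (⟨(0, ((algebraMap R (Subalgebra.center R B) r : Subalgebra.center R B) : B)),
                  inr_mem_center₆ (algebraMap R (Subalgebra.center R B) r).2⟩ : Subalgebra.center R (A × B)) =
                    r • (⟨(0, 1), inr_mem_center₆ (Subalgebra.one_mem _)⟩ : Subalgebra.center R (A × B)) :=
                Subtype.ext (Prod.ext (by simp) (by simp [Algebra.algebraMap_eq_smul_one]))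
              change χ _ = _
              rw [hr, map_smul, h1, Algebra.algebraMap_eq_smul_one] }, fun b ↦ rfl⟩

/-- A character of the centre of `A × B` is `1` on exactly one of the central idempotents `(1,0)`, `(0,1)` (their images
are complementary idempotents of the field `C`). [folklore] -/
private theorem map_inl_one_eq_one_or₆ (χ : Subalgebra.center R (A × B) →ₐ[R] C) :
    (χ ⟨(1, 0), inl_mem_center₆ (Subalgebra.one_mem _)⟩ = 1 ∧ χ ⟨(0, 1), inr_mem_center₆ (Subalgebra.one_mem _)⟩ = 0) ∨
      (χ ⟨(1, 0), inl_mem_center₆ (Subalgebra.one_mem _)⟩ = 0 ∧ χ ⟨(0, 1), inr_mem_center₆ (Subalgebra.one_mem _)⟩ = 1) := by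
  have hsum : (⟨(1, 0), inl_mem_center₆ (Subalgebra.one_mem _)⟩ : Subalgebra.center R (A × B)) +
      ⟨(0, 1), inr_mem_center₆ (Subalgebra.one_mem _)⟩ = 1 :=
    Subtype.ext (Prod.ext (by simp) (by simp))
  have hidem : (⟨(1, 0), inl_mem_center₆ (Subalgebra.one_mem _)⟩ : Subalgebra.center R (A × B)) *
      ⟨(1, 0), inl_mem_center₆ (Subalgebra.one_mem _)⟩ = ⟨(1, 0), inl_mem_center₆ (Subalgebra.one_mem _)⟩ :=
    Subtype.ext (Prod.ext (by simp) (by simp))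
  have hχsum := congrArg χ hsum
  rw [map_add, map_one] at hχsum
  have h01 : χ ⟨(1, 0), inl_mem_center₆ (Subalgebra.one_mem _)⟩ *
      (χ ⟨(1, 0), inl_mem_center₆ (Subalgebra.one_mem _)⟩ - 1) = 0 := by
    rw [mul_sub, mul_one, ← map_mul, hidem, sub_self]
  rcases mul_eq_zero.1 h01 with h | h
  · exact Or.inr ⟨h, by rw [h, zero_add] at hχsum; exact hχsum⟩
  · have h1 : χ ⟨(1, 0), inl_mem_center₆ (Subalgebra.one_mem _)⟩ = 1 := sub_eq_zero.1 h
    refine Or.inl ⟨h1, ?_⟩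
    rw [h1] at hχsum
    linear_combination hχsum

/-- **A character of the centre of a product of two algebras factors through the centre of one factor**: if
`χ : Z(A × B) → C` (`C` a field) takes the value `t`, then `t` is a value of a character of `Z(A)` or of `Z(B)` —
the step «`C = K₁ × ⋯ × K_m × F₁ × ⋯ × F_n` … there exists an embedding `k → F_i`» of the proof of Prop. (3.8),
for a binary product. [cite: MoonenZarhin1999LowDim, §3 Prop. (3.8), proof (p0007 L65–L74)]
[cite: Lange2023AbelianVarietiesComplex, §2.4.4 Cor. 2.4.26 (proof, p. 124)] -/
theorem exists_algHom_center_or_of_mem_range_algHom_center_prod (χ : Subalgebra.center R (A × B) →ₐ[R] C) {t : C}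
    (ht : t ∈ χ.range) :
    (∃ χ₁ : Subalgebra.center R A →ₐ[R] C, t ∈ χ₁.range) ∨ (∃ χ₂ : Subalgebra.center R B →ₐ[R] C, t ∈ χ₂.range) := by
  obtain ⟨z, rfl⟩ := (AlgHom.mem_range _).1 ht
  have hz1 := fst_mem_center₆ z.2
  have hz2 := snd_mem_center₆ z.2
  -- `z = (z₁, 0) + (0, z₂)`, `(z₁, 0) = (z₁, 0)·(1, 0)`, `(0, z₂) = (0, z₂)·(0, 1)`
  have hsplit : z = ⟨((z : A × B).1, 0), inl_mem_center₆ hz1⟩ + ⟨(0, (z : A × B).2), inr_mem_center₆ hz2⟩ :=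
    Subtype.ext (Prod.ext (by simp) (by simp))
  have hmul1 : (⟨((z : A × B).1, 0), inl_mem_center₆ hz1⟩ : Subalgebra.center R (A × B)) =
      ⟨((z : A × B).1, 0), inl_mem_center₆ hz1⟩ * ⟨(1, 0), inl_mem_center₆ (Subalgebra.one_mem _)⟩ :=
    Subtype.ext (Prod.ext (by simp) (by simp))
  have hmul2 : (⟨(0, (z : A × B).2), inr_mem_center₆ hz2⟩ : Subalgebra.center R (A × B)) =
      ⟨(0, (z : A × B).2), inr_mem_center₆ hz2⟩ * ⟨(0, 1), inr_mem_center₆ (Subalgebra.one_mem _)⟩ :=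
    Subtype.ext (Prod.ext (by simp) (by simp))
  rcases map_inl_one_eq_one_or₆ χ with ⟨h1, h0⟩ | ⟨h0, h1⟩
  · obtain ⟨χ₁, hχ₁⟩ := exists_algHom_center_fst₆ χ h1
    refine Or.inl ⟨χ₁, (AlgHom.mem_range _).2 ⟨⟨_, hz1⟩, ?_⟩⟩
    rw [hχ₁]
    conv_rhs => rw [hsplit, map_add, hmul2, map_mul, h0, mul_zero, add_zero]
  · obtain ⟨χ₂, hχ₂⟩ := exists_algHom_center_snd₆ χ h1
    refine Or.inr ⟨χ₂, (AlgHom.mem_range _).2 ⟨⟨_, hz2⟩, ?_⟩⟩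
    rw [hχ₂]
    conv_rhs => rw [hsplit, map_add, hmul1, map_mul, h0, mul_zero, zero_add]

/-- The same for an algebra `A'` ISOMORPHIC to a product `A × B` (e.g. `End⁰(X₁ × X₂) ≅ End⁰(X₁) × End⁰(X₂)` when
`Hom(X₁, X₂) = 0 = Hom(X₂, X₁)`): a value of a character of `Z(A')` is a value of a character of `Z(A)` or of `Z(B)`.
[cite: MoonenZarhin1999LowDim, §3 Prop. (3.8), proof (p0007 L65–L74)] [cite: Lange2023AbelianVarietiesComplex, §2.4.4 Cor. 2.4.26 (proof, p. 124)] -/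
theorem exists_algHom_center_or_of_mem_range_algHom_center_of_algEquiv_prod {A' : Type*} [Ring A'] [Algebra R A']
    (e : A' ≃ₐ[R] A × B) (χ : Subalgebra.center R A' →ₐ[R] C) {t : C} (ht : t ∈ χ.range) :
    (∃ χ₁ : Subalgebra.center R A →ₐ[R] C, t ∈ χ₁.range) ∨ (∃ χ₂ : Subalgebra.center R B →ₐ[R] C, t ∈ χ₂.range) := by
  -- pull `χ` back to the centre of `A × B` along `e⁻¹`
  have hmem : ∀ z : Subalgebra.center R (A × B),
      ((e.symm : A × B →ₐ[R] A').comp (Subalgebra.center R (A × B)).val) z ∈ Subalgebra.center R A' := fun z ↦ by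
    change e.symm (z : A × B) ∈ Subalgebra.center R A'
    refine Subalgebra.mem_center_iff.2 fun b ↦ e.injective ?_
    rw [map_mul, map_mul, AlgEquiv.apply_symm_apply]
    exact Subalgebra.mem_center_iff.1 z.2 (e b)
  refine exists_algHom_center_or_of_mem_range_algHom_center_prod
    (χ.comp (AlgHom.codRestrict _ (Subalgebra.center R A') hmem)) ?_
  obtain ⟨z, rfl⟩ := (AlgHom.mem_range _).1 ht
  have hz' : e (z : A') ∈ Subalgebra.center R (A × B) := Subalgebra.mem_center_iff.2 fun p ↦ by
    apply e.symm.injective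
    rw [map_mul, map_mul, AlgEquiv.symm_apply_apply]
    exact Subalgebra.mem_center_iff.1 z.2 (e.symm p)
  refine (AlgHom.mem_range _).2 ⟨⟨e z, hz'⟩, ?_⟩
  rw [AlgHom.comp_apply]
  congr 1
  apply Subtype.ext
  change e.symm (e (z : A')) = z
  exact e.symm_apply_apply (z : A')

end CentreOfProduct

/-! ## §2 A character of `Z(End⁰(E_{τ'})) = End⁰(E_{τ'})` with a non-real value `t` has `t ∈ ℚ + ℚτ'` -/

section EllipticFactor

variable {τ' : ℂ} (hτ' : τ'.im ≠ 0)

/-- **`End⁰(E_{τ'})` is `ℚ` or the imaginary quadratic field `ℚ(τ')`, so a `ℚ`-algebra character of (the centre of)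
`End⁰(E_{τ'})` with a NON-REAL value `t` has `t ∈ ℚ + ℚτ'`**: `End⁰(E_{τ'}) = ℚ·1 + ℚ·M` with `M` the matrix of
multiplication by `τ'` (`M² + pM + q = 0` where `τ'² + pτ' + q = 0`), and `χ(M) ∈ {τ', τ̄' = −p − τ'}`.
[cite: Lange2023AbelianVarietiesComplex, §5.1.5 Exercise (1) and §2.6.1 (table: `End_ℚ` of an elliptic curve)]
[cite: MoonenZarhin1999LowDim, §3 Prop. (3.8), proof (p0007 L65–L74: «an embedding `k → F_i`»)] -/
theorem mem_span_one_tau_of_mem_range_algHom_center_endAlgRat_ellipticPeriod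
    (χ : Subalgebra.center ℚ (endAlgRat (ellipticPeriod hτ')) →ₐ[ℚ] ℂ) {t : ℂ} (ht : t ∈ χ.range) (hti : t.im ≠ 0) :
    t ∈ Submodule.span ℚ (Set.range ![(1 : ℂ), τ']) := by
  obtain ⟨c, rfl⟩ := (AlgHom.mem_range _).1 ht
  by_cases hE : ellipticEnd hτ' = ⊥
  · -- `End⁰(E_{τ'}) = ℚ`: every value of `χ` is rational, hence real
    exfalso
    have hc : ((c : endAlgRat (ellipticPeriod hτ')) : Matrix (Fin 2) (Fin 2) ℚ) ∈
        (⊥ : Subalgebra ℚ (Matrix (Fin 2) (Fin 2) ℚ)) := by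
      rw [← (endAlgRat_ellipticPeriod_eq_bot_iff hτ').2 hE]
      exact (c : endAlgRat (ellipticPeriod hτ')).2
    obtain ⟨q, hq⟩ := Set.mem_range.1 (Algebra.mem_bot.1 hc)
    have hcq : c = algebraMap ℚ (Subalgebra.center ℚ (endAlgRat (ellipticPeriod hτ'))) q :=
      Subtype.ext (Subtype.ext (by rw [Subalgebra.coe_algebraMap, Subalgebra.coe_algebraMap, hq]))
    apply hti
    rw [hcq, AlgHom.commutes, eq_ratCast, Complex.ratCast_im]
  · obtain ⟨p, q, hpq⟩ := (ellipticEnd_ne_bot_iff hτ').1 hE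
    -- `M`, the matrix of multiplication by `τ'` on the basis `(τ', 1)`
    set M : Matrix (Fin 2) (Fin 2) ℚ := !![0 - 1 * p, 1; -1 * q, 0] with hM_def
    have hM : M ∈ endAlgRat (ellipticPeriod hτ') := (mem_endAlgRat_ellipticPeriod_iff_of_quadratic hτ' hpq).2 ⟨0, 1, rfl⟩
    have hdec : ∀ X ∈ endAlgRat (ellipticPeriod hτ'), ∃ a b : ℚ, X = a • (1 : Matrix (Fin 2) (Fin 2) ℚ) + b • M := by
      intro X hX
      obtain ⟨a, b, rfl⟩ := (mem_endAlgRat_ellipticPeriod_iff_of_quadratic hτ' hpq).1 hX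
      refine ⟨a, b, ?_⟩
      rw [hM_def]
      ext i j
      fin_cases i <;> fin_cases j <;> simp
      ring
    -- `End⁰(E_{τ'}) = ℚ·1 + ℚ·M` is commutative: `M` is central
    have hMc : (⟨M, hM⟩ : endAlgRat (ellipticPeriod hτ')) ∈ Subalgebra.center ℚ (endAlgRat (ellipticPeriod hτ')) := by
      refine Subalgebra.mem_center_iff.2 fun X ↦ Subtype.ext ?_
      obtain ⟨a, b, hX⟩ := hdec X.1 X.2
      change (X : Matrix (Fin 2) (Fin 2) ℚ) * M = M * (X : Matrix (Fin 2) (Fin 2) ℚ)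
      rw [hX, add_mul, mul_add, smul_mul_assoc, smul_mul_assoc, mul_smul_comm, mul_smul_comm, one_mul, mul_one]
    set m : Subalgebra.center ℚ (endAlgRat (ellipticPeriod hτ')) := ⟨⟨M, hM⟩, hMc⟩ with hm_def
    -- `μ = χ(M)` is a root of `x² + px + q`, i.e. `μ ∈ {τ', -p - τ'}`
    have hMM : M * M + p • M + q • (1 : Matrix (Fin 2) (Fin 2) ℚ) = 0 := by
      rw [hM_def]
      ext i j
      fin_cases i <;> fin_cases j <;> simp
      ring
    have hmM : ((m : endAlgRat (ellipticPeriod hτ')) : Matrix (Fin 2) (Fin 2) ℚ) = M := rfl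
    have hmm : m * m + p • m + algebraMap ℚ (Subalgebra.center ℚ (endAlgRat (ellipticPeriod hτ'))) q = 0 := by
      apply Subtype.ext
      apply Subtype.ext
      simp only [Subalgebra.coe_add, Subalgebra.coe_mul, Subalgebra.coe_smul, Subalgebra.coe_zero,
        Algebra.algebraMap_eq_smul_one, hmM]
      exact hMM
    have hμ : χ m ^ 2 + p * χ m + q = 0 := by
      have h := congrArg χ hmm
      rw [map_add, map_add, map_mul, map_smul, AlgHom.commutes, map_zero, eq_ratCast, Rat.smul_def] at h
      rw [sq]
      exact h
    have hμmem : χ m ∈ Submodule.span ℚ (Set.range ![(1 : ℂ), τ']) := by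
      have hprod : (χ m - τ') * (χ m + p + τ') = 0 := by linear_combination hμ - hpq
      rcases mul_eq_zero.1 hprod with h | h
      · exact (mem_span_one_tau_iff τ').2 ⟨0, 1, by push_cast; linear_combination h⟩
      · exact (mem_span_one_tau_iff τ').2 ⟨-p, -1, by push_cast; linear_combination h⟩
    -- `c = a·1 + b·M`, so `χ(c) = a + b·μ ∈ ℚ + ℚτ'`
    obtain ⟨a, b, hc⟩ := hdec _ (c : endAlgRat (ellipticPeriod hτ')).2
    have hc' : c = a • (1 : Subalgebra.center ℚ (endAlgRat (ellipticPeriod hτ'))) + b • m := by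
      apply Subtype.ext
      apply Subtype.ext
      simp only [Subalgebra.coe_add, Subalgebra.coe_smul, Subalgebra.coe_one, hmM]
      exact hc
    rw [hc', map_add, map_smul, map_smul, map_one]
    exact add_mem (Submodule.smul_mem _ a ((mem_span_one_tau_iff τ').2 ⟨1, 0, by simp⟩)) (Submodule.smul_mem _ b hμmem)

/-- Hence **a character of `Z(End⁰(E_{τ'}))` with the non-real value `τ` makes `E_{τ'}` isogenous to `E_τ`** («an
embedding of `k = End⁰(E_τ)` into `End⁰(E_{τ'})`»: elliptic curves with complex multiplication by the same imaginary
quadratic field are isogenous). [cite: MoonenZarhin1999LowDim, §3 Prop. (3.8) and §5 (5.4)–(5.5) (p0009 L82–L97)]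
[cite: Silverman1994, Ch. II Exercise 2.3] [cite: Lange2023AbelianVarietiesComplex, §5.1.5 Exercise (1)] -/
theorem isIsogenous_ellipticPeriod_of_mem_range_algHom_center_endAlgRat {τ : ℂ} (hτ : τ.im ≠ 0)
    (χ : Subalgebra.center ℚ (endAlgRat (ellipticPeriod hτ')) →ₐ[ℚ] ℂ) (hτχ : τ ∈ χ.range) :
    IsIsogenous (ellipticPeriod hτ') (ellipticPeriod hτ) :=
  isIsogenous_ellipticPeriod_of_mem_span_one_tau hτ' hτ
    (mem_span_one_tau_of_mem_range_algHom_center_endAlgRat_ellipticPeriod hτ' χ hτχ hτ)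

end EllipticFactor

/-! ## §3 Prop. (3.8) for a product `X = X₁ × X₂` with `Hom(X₁, X₂) = 0 = Hom(X₂, X₁)` and a CM curve `E_τ` -/

section ProductFactor

variable {ι₁ ι₂ : Type*} [Fintype ι₁] [Fintype ι₂] [DecidableEq ι₁] [DecidableEq ι₂] {E₁ E₂ : Type*}
  [NormedAddCommGroup E₁] [NormedSpace ℂ E₁] [NormedAddCommGroup E₂] [NormedSpace ℂ E₂]
  {Φ₁ : (ι₁ → ℝ) ≃L[ℝ] E₁} {Φ₂ : (ι₂ → ℝ) ≃L[ℝ] E₂} {τ : ℂ} (hτ : τ.im ≠ 0)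

/-- **MOONEN–ZARHIN (3.8), CM HALF, FOR A PRODUCT `X = X₁ × X₂` with `Hom(X₁, X₂) = 0 = Hom(X₂, X₁)`**: if `E_τ` has
complex multiplication and `Hg(X × E_τ)(ℂ) ≠ Hg(X)(ℂ) × Hg(E_τ)(ℂ)`, then `k = ℚ(τ)` embeds into the centre of
`End⁰(X₁)` or of `End⁰(X₂)` — `τ` is a value of a `ℚ`-algebra character of `Z(End⁰ X₁)` or of `Z(End⁰ X₂)`
(`End⁰(X) = End⁰(X₁) × End⁰(X₂)`, «`C = K₁ × ⋯ × F_n` … an embedding `k → F_i`»).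
[cite: MoonenZarhin1999LowDim, §3 Prop. (3.8) with proof (p0007 L55–L74)] [cite: Lange2023AbelianVarietiesComplex, §2.4.4 Cor. 2.4.26 (proof, p. 124)] -/
theorem IsAbelianVariety.exists_algHom_center_endAlgRat_or_of_hodgeGroupC_prod_prod_ellipticPeriod_ne
    (hX₁ : IsAbelianVariety Φ₁) (hX₂ : IsAbelianVariety Φ₂) (h₁₂ : homRat Φ₁ Φ₂ = ⊥) (h₂₁ : homRat Φ₂ Φ₁ = ⊥)
    (hCM : ellipticEnd hτ ≠ ⊥)
    (hne : hodgeGroupC (prodPeriod (prodPeriod Φ₁ Φ₂) (ellipticPeriod hτ)) ≠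
      blockDiagProd (hodgeGroupC (prodPeriod Φ₁ Φ₂)) (hodgeGroupC (ellipticPeriod hτ))) :
    (∃ χ₁ : Subalgebra.center ℚ (endAlgRat Φ₁) →ₐ[ℚ] ℂ, τ ∈ χ₁.range) ∨
      (∃ χ₂ : Subalgebra.center ℚ (endAlgRat Φ₂) →ₐ[ℚ] ℂ, τ ∈ χ₂.range) := by
  obtain ⟨-, -, χ, -, hτχ⟩ :=
    (hX₁.prod hX₂).exists_eigencharacter_center_endAlgRat_of_hodgeGroupC_prod_ellipticPeriod_ne hτ hCM hne
  exact exists_algHom_center_or_of_mem_range_algHom_center_of_algEquiv_prod (endAlgRatProdEquiv Φ₁ Φ₂ h₁₂ h₂₁) χ hτχ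

/-- **(3.8) FOR `X = X₁ × E_{τ'}` (`Hom(X₁, E_{τ'}) = 0 = Hom(E_{τ'}, X₁)`) AND A CM CURVE `E_τ`**: if
`Hg(X × E_τ)(ℂ) ≠ Hg(X)(ℂ) × Hg(E_τ)(ℂ)` then `ℚ(τ)` embeds into `Z(End⁰ X₁)` (a character with value `τ`) or
`E_{τ'} ∼ E_τ` (the elliptic factor receives `k`: then `X × E_τ ∼ X₁ × E_τ²`, the case `r = 2` of (5.4)).
[cite: MoonenZarhin1999LowDim, §3 Prop. (3.8) (p0007 L55–L74) and §5 (5.4)–(5.5) (p0009 L82–L97)] -/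
theorem IsAbelianVariety.exists_algHom_center_endAlgRat_or_isIsogenous_of_hodgeGroupC_prod_ellipticPeriod_prod_ellipticPeriod_ne
    {τ' : ℂ} (hτ' : τ'.im ≠ 0) (hX₁ : IsAbelianVariety Φ₁) (h₁₂ : homRat Φ₁ (ellipticPeriod hτ') = ⊥)
    (h₂₁ : homRat (ellipticPeriod hτ') Φ₁ = ⊥) (hCM : ellipticEnd hτ ≠ ⊥)
    (hne : hodgeGroupC (prodPeriod (prodPeriod Φ₁ (ellipticPeriod hτ')) (ellipticPeriod hτ)) ≠
      blockDiagProd (hodgeGroupC (prodPeriod Φ₁ (ellipticPeriod hτ'))) (hodgeGroupC (ellipticPeriod hτ))) :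
    (∃ χ₁ : Subalgebra.center ℚ (endAlgRat Φ₁) →ₐ[ℚ] ℂ, τ ∈ χ₁.range) ∨
      IsIsogenous (ellipticPeriod hτ') (ellipticPeriod hτ) := by
  rcases hX₁.exists_algHom_center_endAlgRat_or_of_hodgeGroupC_prod_prod_ellipticPeriod_ne hτ
    (isAbelianVariety_ellipticPeriod hτ') h₁₂ h₂₁ hCM hne with h | ⟨χ₂, hτχ₂⟩
  · exact Or.inl h
  · exact Or.inr (isIsogenous_ellipticPeriod_of_mem_range_algHom_center_endAlgRat hτ' hτ χ₂ hτχ₂)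

end ProductFactor

/-! ## §4 `(Y × E_{τ'}) × E_τ` for an abelian surface `Y` -/

section Plumbing

/-- `E_τ = E_{τ'}` as period presentations when `τ = τ'`. [folklore] -/
private theorem ellipticPeriod_congr₆ {τ τ' : ℂ} {hτ : τ.im ≠ 0} {hτ' : τ'.im ≠ 0} (h : τ = τ') :
    ellipticPeriod hτ = ellipticPeriod hτ' := by
  subst h
  rfl

/-- The family `(σ₀, …, σ_{N−1}, τ)` of non-real periods. [folklore] -/
private theorem forall_im_snoc_ne_zero₆ {N : ℕ} {σ : Fin N → ℂ} (hσ : ∀ k, (σ k).im ≠ 0) {τ : ℂ} (hτ : τ.im ≠ 0) :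
    ∀ k, ((Fin.snoc σ τ : Fin (N + 1) → ℂ) k).im ≠ 0 := fun k ↦ by
  induction k using Fin.lastCases with
  | last => rwa [Fin.snoc_last]
  | cast i => rw [Fin.snoc_castSucc]; exact hσ i

/-- `X × E_τ ∼ E_{ρ₀} × ⋯ × E_{ρ_N}` when `X ∼ E_{ρ₀} × ⋯ × E_{ρ_{N-1}}` and `ρ_N = τ`. [cite: Lange2023AbelianVarietiesComplex, §1.1.2 (products, p. 21) and Cor. 1.1.16] -/
private theorem isIsogenous_prod_ellipticPeriod_piPeriod_snoc₆ {ι : Type*} [Fintype ι] [DecidableEq ι] {F : Type*}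
    [NormedAddCommGroup F] [NormedSpace ℂ F] {Φ : (ι → ℝ) ≃L[ℝ] F} {N : ℕ} {σ : Fin N → ℂ} (hσ : ∀ k, (σ k).im ≠ 0)
    {τ : ℂ} (hτ : τ.im ≠ 0) (h : IsIsogenous Φ (piPeriod fun k ↦ ellipticPeriod (hσ k))) :
    IsIsogenous (prodPeriod Φ (ellipticPeriod hτ))
      (piPeriod fun k ↦ ellipticPeriod (forall_im_snoc_ne_zero₆ hσ hτ k)) := by
  have hρ := forall_im_snoc_ne_zero₆ hσ hτ
  have hfam : (fun k ↦ ellipticPeriod (hσ k)) = fun k : Fin N ↦ ellipticPeriod (hρ k.castSucc) :=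
    funext fun k ↦ ellipticPeriod_congr₆ (by simp)
  rw [hfam] at h
  exact IsIsogenous.trans _ _ _ (h.prod (IsIsogenous.refl (ellipticPeriod hτ)))
    (isIsomorphic_prodPeriod_piPeriod_ellipticPeriod_castSucc hρ hτ (by rw [Fin.snoc_last])).isIsogenous

end Plumbing

section Surface

variable {κ : Type} [Fintype κ] [DecidableEq κ] {E : Type} [NormedAddCommGroup E] [NormedSpace ℂ E]
  [FiniteDimensional ℂ E] {Ψ : (κ → ℝ) ≃L[ℝ] E} {η : E [⋀^Fin 2]→L[ℝ] ℝ} {τ' τ : ℂ} (hτ' : τ'.im ≠ 0) (hτ : τ.im ≠ 0)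

/-- **FOR A SIMPLE ABELIAN SURFACE `Y` AND A CM CURVE `E_τ`: `Hg((Y × E_{τ'}) × E_τ)(ℂ) ≠ Hg(Y × E_{τ'})(ℂ) × Hg(E_τ)(ℂ)`
FORCES `E_{τ'} ∼ E_τ`** — the centre of `End⁰(Y × E_{τ'}) = End⁰(Y) × End⁰(E_{τ'})` is `Z(End⁰ Y) × End⁰(E_{τ'})`;
`k = ℚ(τ)` does not embed into `Z(End⁰ Y)` («the center of `End⁰(X₂)` does not contain an imaginary quadratic field»,
g51-#1), so it embeds into `End⁰(E_{τ'})`. [cite: MoonenZarhin1999LowDim, §3 Prop. (3.8) (p0007 L55–L74), §5 (5.2) (p0008 L101–L105) and (5.4)–(5.5) (p0009 L82–L97)]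
[cite: Lange2023AbelianVarietiesComplex, §2.4.4 Cor. 2.4.26] -/
theorem IsSimple.isIsogenous_ellipticPeriod_of_hodgeGroupC_prod_ellipticPeriod_prod_ellipticPeriod_ne (hY : IsSimple Ψ)
    (hη : IsRiemannForm Ψ η) (h2 : finrank ℂ E = 2) (hCM : ellipticEnd hτ ≠ ⊥)
    (hne : hodgeGroupC (prodPeriod (prodPeriod Ψ (ellipticPeriod hτ')) (ellipticPeriod hτ)) ≠
      blockDiagProd (hodgeGroupC (prodPeriod Ψ (ellipticPeriod hτ'))) (hodgeGroupC (ellipticPeriod hτ))) :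
    IsIsogenous (ellipticPeriod hτ') (ellipticPeriod hτ) := by
  haveI : Nonempty κ := Fintype.card_pos_iff.1 (by rw [card_eq_two_mul_finrank Ψ, h2]; norm_num)
  have hcard : Fintype.card κ ≠ Fintype.card (Fin 2) := by rw [card_eq_two_mul_finrank Ψ, h2, Fintype.card_fin]; norm_num
  rcases IsAbelianVariety.exists_algHom_center_endAlgRat_or_isIsogenous_of_hodgeGroupC_prod_ellipticPeriod_prod_ellipticPeriod_ne
      hτ hτ' ⟨η, hη⟩ (hY.homRat_eq_bot_of_card_ne (isSimple_ellipticPeriod hτ') hcard)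
      ((isSimple_ellipticPeriod hτ').homRat_eq_bot_of_card_ne hY fun h ↦ hcard h.symm) hCM hne with ⟨χ₁, hτχ₁⟩ | h
  · -- a character of `Z(End⁰ Y)` with the imaginary quadratic value `τ`: impossible for a simple surface
    exfalso
    obtain ⟨c, hc⟩ := (AlgHom.mem_range χ₁).1 hτχ₁
    obtain ⟨p, q, hpq⟩ := (ellipticEnd_ne_bot_iff hτ).1 hCM
    obtain ⟨φ, hφ⟩ : ∃ φ : centerField Ψ hY →+* ℂ, ∀ x, φ x = χ₁ x := ⟨χ₁.toRingHom, fun _ ↦ rfl⟩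
    have hc' : φ c = τ := (hφ c).trans hc
    have him := hY.im_eq_zero_of_sq_add_eq_zero_of_finrank_eq_two hη h2 φ c (p := p) (q := q) (by rw [hc']; exact hpq)
    rw [hc'] at him
    exact hτ him
  · exact h

/-- Hence **`Hg((Y × E_{τ'}) × E_τ)(ℂ) = Hg(Y × E_{τ'})(ℂ) × Hg(E_τ)(ℂ)` for a simple abelian surface `Y`, a CM curve
`E_τ` and `E_{τ'}` NOT isogenous to `E_τ`** («not in case (a) … no embedding of `End⁰(X₁)` into the center of
`End⁰(X₂)` … `Hg(X) = Hg(X₁) × Hg(X₂^r)`»). [cite: MoonenZarhin1999LowDim, §5 (5.5) (p0009 L93–L97) and §3 Prop. (3.8)] -/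
theorem IsSimple.hodgeGroupC_prod_ellipticPeriod_prod_ellipticPeriod_eq_blockDiagProd_of_not_isIsogenous
    (hY : IsSimple Ψ) (hη : IsRiemannForm Ψ η) (h2 : finrank ℂ E = 2) (hCM : ellipticEnd hτ ≠ ⊥)
    (hni : ¬ IsIsogenous (ellipticPeriod hτ') (ellipticPeriod hτ)) :
    hodgeGroupC (prodPeriod (prodPeriod Ψ (ellipticPeriod hτ')) (ellipticPeriod hτ)) =
      blockDiagProd (hodgeGroupC (prodPeriod Ψ (ellipticPeriod hτ'))) (hodgeGroupC (ellipticPeriod hτ)) := by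
  by_contra hne
  exact hni (hY.isIsogenous_ellipticPeriod_of_hodgeGroupC_prod_ellipticPeriod_prod_ellipticPeriod_ne hτ' hτ hη h2 hCM hne)

omit [FiniteDimensional ℂ E] in
/-- `(Y × E') × E ∼ Y × E²` when `E' ∼ E`. [cite: Lange2023AbelianVarietiesComplex, §1.1.2 (products, p. 21) and Cor. 1.1.16] -/
private theorem isIsogenous_prod_prod_powPeriod_two₆ (h : IsIsogenous (ellipticPeriod hτ') (ellipticPeriod hτ)) :
    IsIsogenous (prodPeriod (prodPeriod Ψ (ellipticPeriod hτ')) (ellipticPeriod hτ))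
      (prodPeriod Ψ (powPeriod (ellipticPeriod hτ) 2)) :=
  IsIsogenous.trans _ _ _ (((IsIsogenous.refl Ψ).prod h).prod (IsIsogenous.refl (ellipticPeriod hτ)))
    ((isIsomorphic_prodPeriod_assoc Ψ (ellipticPeriod hτ) (ellipticPeriod hτ)).trans
      ((IsIsomorphic.refl Ψ).prod
        (((isIsomorphic_powPeriod_one (ellipticPeriod hτ)).prod (IsIsomorphic.refl (ellipticPeriod hτ))).trans
          (isIsomorphic_powPeriod_succ (ellipticPeriod hτ) 1).symm))).isIsogenous

/-- **`(Y × E_{τ'}) × E_τ` SATISFIES CONDITION (D) for a SIMPLE polarised abelian surface `Y` and all `τ', τ`**: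
`E_τ` without complex multiplication — g51-#5 ∕ the tree's non-CM elliptic factor theorem with (D) for `Y × E_{τ'}`;
`E_τ` with complex multiplication and `E_{τ'} ≁ E_τ` — the Hodge group splits (previous theorem) and (3.1) transfers
(D) from `Y × E_{τ'}` (g51-#1) and `E_τ` (Tate); `E_{τ'} ∼ E_τ` — `(Y × E_{τ'}) × E_τ ∼ Y × E_τ²`, «reduced to the case
`g ≤ 3`» by Hazama's power remark from (D) for `Y × E_τ`.
[cite: MoonenZarhin1999LowDim, §5 (5.4)–(5.5) (p0009 L82–L97), §3 (3.1), Prop. (3.8)] [cite: Gordon1997, 7.6.1–7.6.2] -/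
theorem IsSimple.forall_divisorClasses_powPeriod_prod_ellipticPeriod_prod_ellipticPeriod_eq_hodgeClasses_of_finrank_eq_two
    (hY : IsSimple Ψ) (hη : IsRiemannForm Ψ η) (h2 : finrank ℂ E = 2) :
    ∀ k p, divisorClasses (powPeriod (prodPeriod (prodPeriod Ψ (ellipticPeriod hτ')) (ellipticPeriod hτ)) k) p =
      hodgeClasses (powPeriod (prodPeriod (prodPeriod Ψ (ellipticPeriod hτ')) (ellipticPeriod hτ)) k) p := by
  haveI : Nonempty κ := Fintype.card_pos_iff.1 (by rw [card_eq_two_mul_finrank Ψ, h2]; norm_num)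
  have hA : IsAbelianVariety (prodPeriod Ψ (ellipticPeriod hτ')) :=
    IsAbelianVariety.prod ⟨η, hη⟩ (isAbelianVariety_ellipticPeriod hτ')
  have hSN := hη.forall_divisorClasses_powPeriod_prod_ellipticPeriod_eq_hodgeClasses_of_finrank_eq_two hτ' h2
  by_cases hE : ellipticEnd hτ = ⊥
  · exact hA.forall_divisorClasses_powPeriod_prod_ellipticPeriod_eq_hodgeClasses_of_ellipticEnd_eq_bot hτ hE hSN
  by_cases hi : IsIsogenous (ellipticPeriod hτ') (ellipticPeriod hτ)
  · -- `r = 2`: `(Y × E') × E ∼ Y × E²`, stably nondegenerate with `Y × E`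
    exact (isIsogenous_prod_prod_powPeriod_two₆ hτ' hτ hi).forall_powPeriod_divisorClasses_eq_hodgeClasses_iff.2
      (IsAbelianVariety.forall_divisorClasses_powPeriod_prod_powPeriod_eq_hodgeClasses_of_prod ⟨η, hη⟩
        (isAbelianVariety_ellipticPeriod hτ)
        (hη.forall_divisorClasses_powPeriod_prod_ellipticPeriod_eq_hodgeClasses_of_finrank_eq_two hτ h2) 2)
  · exact forall_divisorClasses_powPeriod_prod_eq_hodgeClasses_of_hodgeGroupC_prod_eq
      (hY.hodgeGroupC_prod_ellipticPeriod_prod_ellipticPeriod_eq_blockDiagProd_of_not_isIsogenous hτ' hτ hη h2 hE hi) hSN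
      (fun k p ↦ divisorClasses_eq_hodgeClasses_ellipticPow hτ k p)

/-- **`(Y × E_{τ'}) × E_τ` SATISFIES CONDITION (D) FOR EVERY POLARISED ABELIAN SURFACE `Y` AND ALL ELLIPTIC CURVES
`E_{τ'}`, `E_τ`** (non-simple `Y ∼ E_{σ₀} × E_{σ₁}`: a product of four elliptic curves, Cor. (3.9)).
[cite: MoonenZarhin1999LowDim, §5 (5.4)–(5.5) (p0009 L82–L97) and §3 Cor. (3.9) (p0007 L80–L84)] [cite: Gordon1997, Thm. 7.5] -/
theorem IsRiemannForm.forall_divisorClasses_powPeriod_prod_ellipticPeriod_prod_ellipticPeriod_eq_hodgeClasses_of_finrank_eq_two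
    (hη : IsRiemannForm Ψ η) (h2 : finrank ℂ E = 2) :
    ∀ k p, divisorClasses (powPeriod (prodPeriod (prodPeriod Ψ (ellipticPeriod hτ')) (ellipticPeriod hτ)) k) p =
      hodgeClasses (powPeriod (prodPeriod (prodPeriod Ψ (ellipticPeriod hτ')) (ellipticPeriod hτ)) k) p := by
  by_cases hY : IsSimple Ψ
  · exact hY.forall_divisorClasses_powPeriod_prod_ellipticPeriod_prod_ellipticPeriod_eq_hodgeClasses_of_finrank_eq_two
      hτ' hτ hη h2
  · -- `Y ∼ E_{σ₀} × E_{σ₁}`: `(Y × E_{τ'}) × E_τ ∼ E_{σ₀} × E_{σ₁} × E_{τ'} × E_τ`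
    obtain ⟨σ, hσ, hYσ⟩ := hη.exists_isIsogenous_piPeriod_ellipticPeriod_of_not_isSimple_of_finrank_eq_two h2 hY
    exact (isIsogenous_prod_ellipticPeriod_piPeriod_snoc₆ (forall_im_snoc_ne_zero₆ hσ hτ') hτ
      (isIsogenous_prod_ellipticPeriod_piPeriod_snoc₆ hσ hτ'
        hYσ)).forall_divisorClasses_powPeriod_eq_hodgeClasses_of_pi_ellipticPeriod
      (forall_im_snoc_ne_zero₆ (forall_im_snoc_ne_zero₆ hσ hτ') hτ)

/-- The `IsAbelianVariety` form: `(Y × E_{τ'}) × E_τ` satisfies (D) for every complex abelian surface `Y`.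
[cite: MoonenZarhin1999LowDim, §5 (5.4)–(5.5) (p0009 L82–L97)] -/
theorem IsAbelianVariety.forall_divisorClasses_powPeriod_prod_ellipticPeriod_prod_ellipticPeriod_eq_hodgeClasses_of_finrank_eq_two
    (hA : IsAbelianVariety Ψ) (h2 : finrank ℂ E = 2) :
    ∀ k p, divisorClasses (powPeriod (prodPeriod (prodPeriod Ψ (ellipticPeriod hτ')) (ellipticPeriod hτ)) k) p =
      hodgeClasses (powPeriod (prodPeriod (prodPeriod Ψ (ellipticPeriod hτ')) (ellipticPeriod hτ)) k) p := by
  obtain ⟨η, hη⟩ := hA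
  exact hη.forall_divisorClasses_powPeriod_prod_ellipticPeriod_prod_ellipticPeriod_eq_hodgeClasses_of_finrank_eq_two hτ' hτ h2

end Surface

/-! ## §5 `T × E_τ` for a NON-SIMPLE threefold `T`, and Thm. (0.1) (4) for all `T × E_τ` outside case (a) -/

section Threefold

variable {κ : Type} [Fintype κ] [DecidableEq κ] {E : Type} [NormedAddCommGroup E] [NormedSpace ℂ E]
  [FiniteDimensional ℂ E] {Ψ : (κ → ℝ) ≃L[ℝ] E} {η : E [⋀^Fin 2]→L[ℝ] ℝ} {τ : ℂ} (hτ : τ.im ≠ 0)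

/-- **`T × E_τ` SATISFIES CONDITION (D) FOR EVERY NON-SIMPLE POLARISED ABELIAN THREEFOLD `T` AND EVERY ELLIPTIC CURVE
`E_τ`**: `T ∼ Y × E_{τ'}` with `Y` a polarised abelian surface (g51-#2 §1) and `T × E_τ ∼ (Y × E_{τ'}) × E_τ` (§4).
[cite: MoonenZarhin1999LowDim, §5 (5.4)–(5.5) (p0009 L82–L97), Thm. (0.1) (4) (p0001 L131–L135)] [cite: Gordon1997, Thm. 7.5 and 7.6.2] -/
theorem IsRiemannForm.forall_divisorClasses_powPeriod_prod_ellipticPeriod_eq_hodgeClasses_of_not_isSimple_of_finrank_eq_three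
    (hη : IsRiemannForm Ψ η) (h3 : finrank ℂ E = 3) (hX : ¬ IsSimple Ψ) :
    ∀ k p, divisorClasses (powPeriod (prodPeriod Ψ (ellipticPeriod hτ)) k) p =
      hodgeClasses (powPeriod (prodPeriod Ψ (ellipticPeriod hτ)) k) p := by
  obtain ⟨V, hV, hVc, τ', hτ', h2, hiso⟩ :=
    hη.exists_isIsogenous_subtorusPeriod_prod_ellipticPeriod_of_not_isSimple_of_finrank_eq_three h3 hX
  exact (hiso.prod (IsIsogenous.refl (ellipticPeriod hτ))).forall_powPeriod_divisorClasses_eq_hodgeClasses_iff.2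
    ((isRiemannForm_restrict Ψ hη hV hVc).forall_divisorClasses_powPeriod_prod_ellipticPeriod_prod_ellipticPeriod_eq_hodgeClasses_of_finrank_eq_two
      hτ' hτ h2)

/-- The `IsAbelianVariety` form: `T × E_τ` satisfies (D) for every non-simple complex abelian threefold `T` and every
`E_τ`. [cite: MoonenZarhin1999LowDim, §5 (5.4)–(5.5) (p0009 L82–L97)] -/
theorem IsAbelianVariety.forall_divisorClasses_powPeriod_prod_ellipticPeriod_eq_hodgeClasses_of_not_isSimple_of_finrank_eq_three
    (hA : IsAbelianVariety Ψ) (h3 : finrank ℂ E = 3) (hX : ¬ IsSimple Ψ) :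
    ∀ k p, divisorClasses (powPeriod (prodPeriod Ψ (ellipticPeriod hτ)) k) p =
      hodgeClasses (powPeriod (prodPeriod Ψ (ellipticPeriod hτ)) k) p := by
  obtain ⟨η, hη⟩ := hA
  exact hη.forall_divisorClasses_powPeriod_prod_ellipticPeriod_eq_hodgeClasses_of_not_isSimple_of_finrank_eq_three hτ h3 hX

end Threefold

section CaseA

variable {κ : Type} [Fintype κ] [DecidableEq κ] [Nonempty κ] {E : Type} [NormedAddCommGroup E] [NormedSpace ℂ E]
  [FiniteDimensional ℂ E] {Ψ : (κ → ℝ) ≃L[ℝ] E} {η : E [⋀^Fin 2]→L[ℝ] ℝ} {τ : ℂ} (hτ : τ.im ≠ 0)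

/-- **MOONEN–ZARHIN THM. (0.1) (4) FOR THE FOURFOLDS `T × E_τ` OUTSIDE CASE (a): `T × E_τ` SATISFIES CONDITION (D) —
`ℬ•((T × E_τ)ⁿ) = 𝒟•((T × E_τ)ⁿ)` for all `n` — for every polarised complex abelian threefold `T` and every elliptic
curve `E_τ`, provided that when `T` is simple and `E_τ` has complex multiplication by `k = ℚ(τ)` no ring embedding of
the centre `K` of `End⁰(T)` takes the value `τ` (case (a): «`X₂` is a simple abelian threefold such that there exists
an embedding `k ↪ End⁰(X₂)`»).**  Simple `T`: g51-#5; non-simple `T`: this file.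
[cite: MoonenZarhin1999LowDim, Thm. (0.1) (4) (p0001 L131–L135), case (a) (p0001 L77–L80), §5 (5.4)–(5.5) (p0009 L82–L97)]
[cite: Gordon1997, Thm. 7.5 and 7.6.2] -/
theorem IsRiemannForm.forall_divisorClasses_powPeriod_prod_ellipticPeriod_eq_hodgeClasses_of_finrank_eq_three_of_forall_apply_ne
    (hη : IsRiemannForm Ψ η) (h3 : finrank ℂ E = 3)
    (ha : ∀ hX : IsSimple Ψ, ellipticEnd hτ ≠ ⊥ → ∀ φ : centerField Ψ hX →+* ℂ, ∀ c, φ c ≠ τ) :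
    ∀ k p, divisorClasses (powPeriod (prodPeriod Ψ (ellipticPeriod hτ)) k) p =
      hodgeClasses (powPeriod (prodPeriod Ψ (ellipticPeriod hτ)) k) p := by
  by_cases hX : IsSimple Ψ
  · by_cases hE : ellipticEnd hτ = ⊥
    · exact hη.forall_divisorClasses_powPeriod_prod_ellipticPeriod_eq_hodgeClasses_of_finrank_eq_three_of_ellipticEnd_eq_bot
        hτ h3 hE
    · exact hX.forall_divisorClasses_powPeriod_prod_ellipticPeriod_eq_hodgeClasses_of_finrank_eq_three_of_forall_apply_ne
        hτ hη h3 (ha hX hE)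
  · exact hη.forall_divisorClasses_powPeriod_prod_ellipticPeriod_eq_hodgeClasses_of_not_isSimple_of_finrank_eq_three hτ h3 hX

/-- In particular **`T × E_τ` satisfies (D) for EVERY polarised threefold `T` whose endomorphism algebra has totally
real centre when `T` is simple** (types I(1), I(3): no CM factor `F_i` to receive `k`) **and every `E_τ`.**
[cite: MoonenZarhin1999LowDim, Thm. (0.1) (4), §3 Prop. (3.8) proof (p0007 L65–L74) and §5 (5.4)–(5.5)] -/
theorem IsRiemannForm.forall_divisorClasses_powPeriod_prod_ellipticPeriod_eq_hodgeClasses_of_finrank_eq_three_of_isTotallyReal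
    (hη : IsRiemannForm Ψ η) (h3 : finrank ℂ E = 3) (hreal : ∀ hX : IsSimple Ψ, IsTotallyReal (centerField Ψ hX)) :
    ∀ k p, divisorClasses (powPeriod (prodPeriod Ψ (ellipticPeriod hτ)) k) p =
      hodgeClasses (powPeriod (prodPeriod Ψ (ellipticPeriod hτ)) k) p := by
  refine hη.forall_divisorClasses_powPeriod_prod_ellipticPeriod_eq_hodgeClasses_of_finrank_eq_three_of_forall_apply_ne hτ h3
    fun hX _ φ c hc ↦ hτ ?_
  haveI := hreal hX
  rw [← hc, ← (IsTotallyReal.complexEmbedding_isReal φ).coe_embedding_apply c, Complex.ofReal_im]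

end CaseA

end ComplexTorus

end Literature.Geometry.Kaehler
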